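import Literature.MathematicalPhysics.QuantumLattice.FermiRG.FKTLaddersSec1
import Literature.MathematicalPhysics.QuantumLattice.FermiRG.FKTLaddersSectorCounting
import Literature.MathematicalPhysics.QuantumFieldTheory.GaussianToolkit
import HarnessLib

/-!
# Feldman–Knörrer–Trubowitz, *Particle–Hole Ladders*: the resectorization norm bound at `δ⃗ = 0`

Companion of the typer file `FKTLaddersSec1.lean` (F7a, frozen; nothing there is edited) for the cell
`gate-hubbard-kl` (seat hubbard-kl-t11; dag g6 re-point item (2), 2026-08-26): the ANALYTIC CORE of the
proof of Lemma II.16 (`\lemLADresectornorm`; the tree's named fact `FKTLadders.ResectorizationNormBound`,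
licence F-075, is NOT discharged here) of J. Feldman, H. Knörrer, E. Trubowitz, *Particle–Hole Ladders*,
Commun. Math. Phys. **247** (2004) 179–194, arXiv:math-ph/0209044 [FeldmanKnorrerTrubowitz2004Ladders],
in the derivative-free case `δ⃗ = (0,0,0)` and for all sixteen leg-kind components at once.  Locators
`p.N Ln` = chunk `pNNNN.txt` line `n` of the materialised arXiv TeX, as in F7a.

## What the printed proof does (p.13 L37–114) and what is here

For `f` on `𝔜_{ℓ',r'}` and new scales `ℓ ≥ ℓ'`, `r ≥ r'`, the resectorization `f_{Σ_ℓ,Σ_r}`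
(Definition I.18) is a sum over old labels `s'` of convolutions of `f(·, s')` with `∏_ν χ̂_{s_ν}` on the
position legs that change scale.  The proof (i) discards all but `≤ 3⁴` old labels ("because `f` is
sectorized", p.13 L48–53), (ii) moves the differential–decay operators through the convolution by
Leibniz's rule (p.13 L54–85), (iii) bounds `|∫ ∏ χ̂ · D f| ≤ ∫ ∏ |x^β χ̂| |D^α f|`, integrates the spatial
arguments of all position legs but one and uses `∫ dx_ν |x_ν^{β_ν} χ̂_{s_ν}(x_ν - x'_ν)| = ‖x^{β_ν}χ̂_{s_ν}‖_{L¹}`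
(p.13 L58–72), and (iv) feeds in `‖x^β χ̂_s‖_{L¹} ≤ const M^{|β|j}` ((II.5) `\eqnLADchisbnd`, p.13 L91–96,
the tree's `ChiDecayBound`).  THIS FILE proves step (iii)+(iv) at `α = β = 0` for every leg-kind
component (`legNorm_resectFour_le_of_neighbours`: Tonelli over the slice variables of the `L¹–L^∞`
norm, the additivity of the insertion map behind `l1linfLegs`, translation and reflection invariance
of Lebesgue measure on `(legs → ℝ × ℝ²)`, the product formula for `∫ ∏_ν |χ̂_{s_ν}(w_ν)| dw`), and the
label count of step (i) given a NEIGHBOUR MAP (at most three old labels per leg and new label outside of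
which the summands vanish); summed over the components this is
`resectScaledNormMax_zero_le_of_neighbours`:
`|f|^{[0,0,0]}_{ℓ,r} ≤ 3⁴ · max(1,cst)⁴ · |f|^{[0,0,0]}_{ℓ',r'}` — the second inequality of Lemma II.16 at
`δ⃗ = 0` with an explicit constant.  With the sector count of the sibling companion
`FKTLaddersSectorCounting` (`card_filter_extSector_inter_nonempty_le_three`, the geometric half of
(i)) the neighbour map is instantiated, leaving as the ONLY hypothesis the analytic half of (i): the
`s'`-summand `resectTerm` vanishes identically when a new and an old extended sector on some changing
leg are disjoint (`resectScaledNormMax_zero_le_of_support`; that input is the business of the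
support-vanishing companion, which needs leg-integrability of `f` — it is false for Bochner-junk
`totalFT`s).  Step (ii) (`δ⃗ ≠ 0`: Leibniz through `diffDecay`'s iterated `lineDeriv`) is not attempted.

## Hypotheses kept explicit, and why

* `Measurable (fun y => f i y s')` for the components used: the proof is Tonelli on lower Lebesgue
  integrals, and iterated `∫⁻` of non-measurable integrands need not commute; the printed lemma is
  about (smooth) sectorized functions, whereas `ResectorizationNormBound` quantifies over every
  `f : FourLegFn`.  Nothing else is assumed on `f` (no integrability: all quantities are in `ℝ≥0∞`).
* `ChiDecayBound D cst` (from `LadderData.Admissible.chi_decay`) enters only through its `δ = 0`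
  instance `‖χ̂_s‖_{L¹} ≤ cst`; `χ̂` itself is measurable for every `χ` (`measurable_chiHat`:
  continuous if `χ ∈ L¹`, otherwise the defining Bochner integral is identically `0`).
* `1 ≤ l' ≤ l`, `1 ≤ r' ≤ r` as printed; legs whose side does not change scale are not convolved
  (Definition I.18 (ii)), and the all-momentum component is untouched by resectorization
  (`resectFour_eq_self_of_noPos`).

## Contents

§1 invariance of Lebesgue measure on `ℝ × ℝ²` and its finite powers (left/right translations,
reflection); §2 `measurable_chiHat`; §3 the insertion map `legIns` of `l1linfLegs` (`l1linfLegs_eq_iSup`,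
additivity `legIns_sub`, measurability); §4 the abstract leg-wise convolution `convTerm` and its
majorant `convMajor` (helper definitions, proof devices): `enorm_convTerm_le_convMajor` (norm under
the integral + the substitution `x' = y|_P - w`), `measurable_convMajor`, `lintegral_convMajor_legIns_le`
(the slice bound `≤ ∏‖K_μ‖_{L¹} · sup_t slice(|g|)`); §5 `resectTerm` (the `s'`-summand of `resectFour`,
the interface for the support-vanishing step; `resectFour_eq_sum_resectTerm`, `resectTerm_eq_convTerm`
by `rfl`), `lintegral_enorm_chiHat_le_of_chiDecayBound`, `diffDecay_zero`; §6 the component bound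
`legNorm_resectFour_le_of_neighbours`; §7 the all-momentum component, `scaledNorm_zero`,
`scaledNormMax_zero`, and the summed bounds `resectScaledNormMax_zero_le_of_neighbours`,
`resectScaledNormMax_zero_le_of_support`; §8 `lintegral_slice_le_scaledNormMax_zero`,
`integrable_slice_of_scaledNormMax_ne_top` (finite old norm ⇒ every component slice is integrable — the
leg-integrability the support-vanishing step needs) and `resectScaledNormMax_zero_le_of_support'` (the
support input may assume finiteness; the infinite case is trivial).  The four `def`s (`legIns`, `convTerm`, `convMajor`,
`resectTerm`) are functions, not propositions: no named fact is introduced (D-0026), no `instance`,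
no `notation`; nothing about the Hubbard model is asserted.
-/

noncomputable section

open MeasureTheory
open scoped ENNReal

namespace Literature.MathematicalPhysics.QuantumLattice.FermiRG

namespace FKTLadders

/-! ### §1 Lebesgue measure on `SpT = ℝ × ℝ²` and its finite powers: invariances -/

/-- Lebesgue measure on `ℝ × ℝ²` is invariant under left translations. [folklore] -/
private theorem isAddLeftInvariant_volume_SpT : (volume : Measure SpT).IsAddLeftInvariant :=
  Measure.prod.instIsAddLeftInvariant

/-- Lebesgue measure on `ℝ × ℝ²` is invariant under right translations. [folklore] -/
private theorem isAddRightInvariant_volume_SpT : (volume : Measure SpT).IsAddRightInvariant :=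
  Measure.prod.instIsAddRightInvariant

/-- Lebesgue measure on `ℝ × ℝ²` is invariant under `x ↦ -x`. [folklore] -/
private theorem isNegInvariant_volume_SpT : (volume : Measure SpT).IsNegInvariant :=
  Measure.IsAddHaarMeasure.isNegInvariant_of_regular
    ((volume : Measure ℝ).prod (volume : Measure (Fin 2 → ℝ)))

/-- Lebesgue measure on a finite power `(ι → ℝ × ℝ²)` is invariant under left translations.
[folklore] -/
private theorem isAddLeftInvariant_volume_pi_SpT {ι : Type*} [Fintype ι] :
    (volume : Measure (ι → SpT)).IsAddLeftInvariant := by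
  haveI := isAddLeftInvariant_volume_SpT
  infer_instance

/-- Lebesgue measure on a finite power `(ι → ℝ × ℝ²)` is invariant under `x ↦ -x`. [folklore] -/
private theorem isNegInvariant_volume_pi_SpT {ι : Type*} [Fintype ι] :
    (volume : Measure (ι → SpT)).IsNegInvariant := by
  haveI := isNegInvariant_volume_SpT
  infer_instance

/-- Lebesgue measure on a finite power `(ι → ℝ × ℝ²)` is invariant under right translations
(from left invariance and commutativity). [folklore] -/
private theorem isAddRightInvariant_volume_pi_SpT {ι : Type*} [Fintype ι] :
    (volume : Measure (ι → SpT)).IsAddRightInvariant := by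
  haveI := isAddLeftInvariant_volume_pi_SpT (ι := ι)
  refine ⟨fun v => ?_⟩
  have : (fun x : ι → SpT => x + v) = fun x => v + x := funext fun x => add_comm x v
  rw [this]
  exact map_add_left_eq_self volume v

/-! ### §2 The pairing and `χ̂`: continuity and measurability -/

/-- The pairing `⟨k, x⟩_-` is jointly continuous. [cite: FeldmanKnorrerTrubowitz2004Ladders, Definition I.4 (p.5 L61)] -/
theorem continuous_mink : Continuous fun p : SpT × SpT => mink p.1 p.2 := by
  unfold mink
  fun_prop

/-- `χ̂` is a measurable function of the position, for every `χ` (if `χ` is integrable `χ̂` is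
continuous, otherwise the defining Bochner integral vanishes identically). [cite: FeldmanKnorrerTrubowitz2004Ladders, §I.7 (p.8 L34–38)] -/
theorem measurable_chiHat (χ : SpT → ℝ) : Measurable (chiHat χ) := by
  unfold chiHat
  refine Measurable.const_mul ?_ _
  by_cases hχ : Integrable (fun k : SpT => (χ k : ℂ))
  · refine Continuous.measurable ?_
    refine continuous_of_dominated (bound := fun k => ‖(χ k : ℂ)‖) ?_ ?_ hχ.norm ?_
    · intro x
      refine AEStronglyMeasurable.mul ?_ hχ.aestronglyMeasurable
      refine Continuous.aestronglyMeasurable ?_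
      refine Complex.continuous_exp.comp ?_
      refine Continuous.neg (Continuous.mul continuous_const ?_)
      exact Complex.continuous_ofReal.comp
        (continuous_mink.comp (Continuous.prodMk continuous_id continuous_const))
    · intro x
      refine Filter.Eventually.of_forall fun k => ?_
      rw [norm_mul, Complex.norm_exp]
      simp [Complex.neg_re, Complex.mul_re]
    · refine Filter.Eventually.of_forall fun k => ?_
      refine Continuous.mul ?_ continuous_const
      refine Complex.continuous_exp.comp ?_
      refine Continuous.neg (Continuous.mul continuous_const ?_)
      exact Complex.continuous_ofReal.comp
        (continuous_mink.comp (Continuous.prodMk continuous_const continuous_id))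
  · have h0 : ∀ x : SpT,
        (∫ k : SpT, Complex.exp (-(Complex.I * (mink k x : ℂ))) * (χ k : ℂ)) = 0 := by
      intro x
      apply integral_undef
      intro hint
      apply hχ
      have hmeas : AEStronglyMeasurable
          (fun k : SpT => Complex.exp (Complex.I * (mink k x : ℂ))) volume := by
        refine Continuous.aestronglyMeasurable ?_
        refine Complex.continuous_exp.comp (Continuous.mul continuous_const ?_)
        exact Complex.continuous_ofReal.comp
          (continuous_mink.comp (Continuous.prodMk continuous_id continuous_const))
      have := hint.bdd_mul (c := 1) hmeas (Filter.Eventually.of_forall fun k => by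
        rw [Complex.norm_exp]; simp [Complex.mul_re])
      refine this.congr (Filter.Eventually.of_forall fun k => ?_)
      simp only
      rw [← mul_assoc, ← Complex.exp_add, add_neg_cancel, Complex.exp_zero, one_mul]
    simp_rw [h0]
    exact measurable_const


/-! ### §3 Slices: the insertion map behind `l1linfLegs` -/

/-- The insertion map used (anonymously) in `l1linfLegs`: the spatial arguments `x` of the position
legs other than `μ₀`, the value `x₀` on leg `μ₀`, and the frozen momenta `k` on the momentum legs,
assembled into one argument vector. [folklore] -/
def legIns (i : LegKind) (k : Fin 4 → SpT) (μ₀ : Fin 4) (x₀ : SpT)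
    (x : {μ : Fin 4 // i μ = 1 ∧ μ ≠ μ₀} → SpT) : Fin 4 → SpT :=
  fun μ => if h' : i μ = 1 ∧ μ ≠ μ₀ then x ⟨μ, h'⟩ else if μ = μ₀ then x₀ else k μ

/-- `l1linfLegs` through `legIns`, for leg kinds with at least one position leg. [cite: FeldmanKnorrerTrubowitz2004Ladders, Definition I.10 (p.6 L117–128)] -/
theorem l1linfLegs_eq_iSup (i : LegKind) (h : (Fin 4 → SpT) → ℂ) (k : Fin 4 → SpT)
    (hi : ∃ μ : Fin 4, i μ = 1) :
    l1linfLegs i h k =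
      ⨆ (μ₀ : {μ : Fin 4 // i μ = 1}), ⨆ (x₀ : SpT),
        ∫⁻ x : ({μ : Fin 4 // i μ = 1 ∧ μ ≠ μ₀.1} → SpT), ‖h (legIns i k μ₀.1 x₀ x)‖ₑ := by
  rw [l1linfLegs, if_pos hi]
  rfl

/-- Translating all arguments of `legIns` by a vector vanishing on the momentum legs is the same as
translating the inserted value and the slice variables. [cite: FeldmanKnorrerTrubowitz2004Ladders, Definition I.10 (p.6 L117–128)] -/
theorem legIns_sub (i : LegKind) (k : Fin 4 → SpT) (μ₀ : Fin 4) (x₀ : SpT)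
    (x : {μ : Fin 4 // i μ = 1 ∧ μ ≠ μ₀} → SpT) (z : Fin 4 → SpT)
    (hz : ∀ μ, i μ = 0 → z μ = 0) :
    legIns i k μ₀ x₀ x - z = legIns i k μ₀ (x₀ - z μ₀) (fun μ => x μ - z μ.1) := by
  funext μ
  simp only [Pi.sub_apply, legIns]
  by_cases h' : i μ = 1 ∧ μ ≠ μ₀
  · simp [h']
  · rw [dif_neg h', dif_neg h']
    by_cases hμ : μ = μ₀
    · simp [hμ]
    · simp only [hμ, if_false]
      have hi0 : i μ = 0 := by
        have h1 : ¬ i μ = 1 := fun h1 => h' ⟨h1, hμ⟩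
        omega
      rw [hz μ hi0, sub_zero]

/-- `legIns` is jointly measurable in the inserted value and the slice variables. [cite: FeldmanKnorrerTrubowitz2004Ladders, Definition I.10 (p.6 L117–128)] -/
theorem measurable_legIns₂ (i : LegKind) (k : Fin 4 → SpT) (μ₀ : Fin 4) :
    Measurable fun p : SpT × ({μ : Fin 4 // i μ = 1 ∧ μ ≠ μ₀} → SpT) =>
      legIns i k μ₀ p.1 p.2 := by
  refine measurable_pi_lambda _ fun μ => ?_
  by_cases h' : i μ = 1 ∧ μ ≠ μ₀
  · simp only [legIns, dif_pos h']
    exact (measurable_pi_apply _).comp measurable_snd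
  · simp only [legIns, dif_neg h']
    by_cases hμ : μ = μ₀
    · simp only [hμ, if_true]; exact measurable_fst
    · simp only [hμ, if_false]; exact measurable_const

/-- `legIns` is measurable in the slice variables. [cite: FeldmanKnorrerTrubowitz2004Ladders, Definition I.10 (p.6 L117–128)] -/
theorem measurable_legIns (i : LegKind) (k : Fin 4 → SpT) (μ₀ : Fin 4) (x₀ : SpT) :
    Measurable (legIns i k μ₀ x₀) :=
  (measurable_legIns₂ i k μ₀).comp (Continuous.prodMk continuous_const continuous_id).measurable


/-! ### §4 Leg-wise convolution: the analytic core (Tonelli and translation invariance) -/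

/-- The Euclidean norm of a finite product of complex numbers, in `ℝ≥0∞`. [folklore] -/
private theorem enorm_prod_complex {β : Type*} (s : Finset β) (f : β → ℂ) :
    ‖∏ b ∈ s, f b‖ₑ = ∏ b ∈ s, ‖f b‖ₑ := by
  rw [enorm_eq_nnnorm, nnnorm_prod, ENNReal.ofNNReal_finsetProd]
  rfl

section Conv

variable (P : Fin 4 → Prop) [DecidablePred P]

/-- The leg-wise convolution term of a resectorization: the legs `μ ∈ P` of `g` are convolved with the
kernels `K_μ` (evaluated at `σ_μ (y_μ - x'_μ)`, `σ_μ = ±1`), the other legs are untouched.  With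
`P` = the set of position legs whose side changes scale, `K_μ = χ̂_{s_μ}` and `σ_μ = (-1)^{b_μ}` this is
the `s'`-summand of `resectFour` (see `resectTerm_eq_convTerm`). [folklore] -/
def convTerm (K : {μ : Fin 4 // P μ} → SpT → ℂ) (σ : {μ : Fin 4 // P μ} → ℝ)
    (g : (Fin 4 → SpT) → ℂ) (y : Fin 4 → SpT) : ℂ :=
  ∫ x' : ({μ : Fin 4 // P μ} → SpT),
    (∏ μ, K μ (σ μ • (y μ.1 - x' μ))) * g (fun μ => if h : P μ then x' ⟨μ, h⟩ else y μ)

/-- The majorant of `convTerm` after the substitution `x'_μ = y_μ - w_μ`: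
`∫ ∏_μ |K_μ(σ_μ w_μ)| · |g(y - w)| dw` (`w` extended by zero off `P`). [folklore] -/
def convMajor (K : {μ : Fin 4 // P μ} → SpT → ℂ) (σ : {μ : Fin 4 // P μ} → ℝ)
    (g : (Fin 4 → SpT) → ℂ) (y : Fin 4 → SpT) : ℝ≥0∞ :=
  ∫⁻ w : ({μ : Fin 4 // P μ} → SpT),
    (∏ μ, ‖K μ (σ μ • w μ)‖ₑ) * ‖g (y - fun μ => if h : P μ then w ⟨μ, h⟩ else 0)‖ₑ

variable {P}

/-- Extension by zero off `P` is measurable. [folklore] -/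
private theorem measurable_extZero :
    Measurable fun (w : {μ : Fin 4 // P μ} → SpT) (μ : Fin 4) => if h : P μ then w ⟨μ, h⟩ else (0 : SpT) := by
  refine measurable_pi_lambda _ fun μ => ?_
  by_cases h : P μ
  · simp only [dif_pos h]; exact measurable_pi_apply _
  · simp only [dif_neg h]; exact measurable_const

/-- The kernel `w ↦ ∏_μ |K_μ(σ_μ w_μ)|` is measurable. [folklore] -/
private theorem measurable_convKernel (K : {μ : Fin 4 // P μ} → SpT → ℂ) (hK : ∀ μ, Measurable (K μ))
    (σ : {μ : Fin 4 // P μ} → ℝ) :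
    Measurable fun w : {μ : Fin 4 // P μ} → SpT => ∏ μ, ‖K μ (σ μ • w μ)‖ₑ := by
  refine Finset.measurable_prod _ fun μ _ => ?_
  exact ((hK μ).comp ((measurable_pi_apply μ).const_smul (σ μ))).enorm

/-- `∫ ∏_μ |K_μ(σ_μ w_μ)| dw = ∏_μ ‖K_μ‖_{L¹}` (Tonelli over the legs and reflection invariance of
Lebesgue measure). [folklore] -/
private theorem lintegral_convKernel_eq_prod (K : {μ : Fin 4 // P μ} → SpT → ℂ)
    (hK : ∀ μ, Measurable (K μ)) (σ : {μ : Fin 4 // P μ} → ℝ) (hσ : ∀ μ, σ μ = 1 ∨ σ μ = -1) :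
    ∫⁻ w : ({μ : Fin 4 // P μ} → SpT), ∏ μ, ‖K μ (σ μ • w μ)‖ₑ = ∏ μ, ∫⁻ t, ‖K μ t‖ₑ := by
  have hmeas : ∀ μ : {μ : Fin 4 // P μ}, Measurable fun t : SpT => ‖K μ (σ μ • t)‖ₑ :=
    fun μ => ((hK μ).comp (measurable_id.const_smul (σ μ))).enorm
  have h := Literature.MathematicalPhysics.QuantumFieldTheory.GaussianToolkit.lintegral_fintype_prod_eq_prod
    (fun _ : {μ : Fin 4 // P μ} => (volume : Measure SpT)) hmeas
  rw [volume_pi, h]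
  refine Finset.prod_congr rfl fun μ _ => ?_
  rcases hσ μ with h1 | h1
  · simp [h1]
  · simp only [h1, neg_one_smul]
    haveI := isNegInvariant_volume_SpT
    exact lintegral_neg_eq_self (μ := volume) (fun t => ‖K μ t‖ₑ)

/-- **Step 1.** `|convTerm(y)| ≤ convMajor(y)`: norm of the Bochner integral under the integral, then
the substitution `x' = y|_P - w` (translation and reflection invariance of Lebesgue measure on
`(P → ℝ × ℝ²)`). No hypothesis on `g`. [cite: FeldmanKnorrerTrubowitz2004Ladders, Lemma II.16, proof (p.13 L55–72)] -/
theorem enorm_convTerm_le_convMajor (K : {μ : Fin 4 // P μ} → SpT → ℂ) (σ : {μ : Fin 4 // P μ} → ℝ)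
    (g : (Fin 4 → SpT) → ℂ) (y : Fin 4 → SpT) :
    ‖convTerm P K σ g y‖ₑ ≤ convMajor P K σ g y := by
  haveI := isAddLeftInvariant_volume_pi_SpT (ι := {μ : Fin 4 // P μ})
  haveI := isNegInvariant_volume_pi_SpT (ι := {μ : Fin 4 // P μ})
  unfold convTerm convMajor
  refine (enorm_integral_le_lintegral_enorm _).trans (le_of_eq ?_)
  rw [← lintegral_sub_left_eq_self (μ := volume)
    (fun w : {μ : Fin 4 // P μ} → SpT =>
      (∏ μ, ‖K μ (σ μ • w μ)‖ₑ) * ‖g (y - fun μ => if h : P μ then w ⟨μ, h⟩ else 0)‖ₑ)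
    (fun μ : {μ : Fin 4 // P μ} => y μ.1)]
  refine lintegral_congr fun x' => ?_
  rw [enorm_mul, enorm_prod_complex]
  have harg : (fun μ => if h : P μ then x' ⟨μ, h⟩ else y μ) =
      y - fun μ => if h : P μ then ((fun μ : {μ : Fin 4 // P μ} => y μ.1) - x') ⟨μ, h⟩ else 0 := by
    funext μ
    by_cases h : P μ
    · simp [h]
    · simp [h]
  rw [harg]
  rfl

/-- **Step 2.** `convMajor` is a measurable function of `y` (for measurable kernels and `g`).
[cite: FeldmanKnorrerTrubowitz2004Ladders, Lemma II.16, proof (p.13 L55–72)] -/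
theorem measurable_convMajor (K : {μ : Fin 4 // P μ} → SpT → ℂ) (hK : ∀ μ, Measurable (K μ))
    (σ : {μ : Fin 4 // P μ} → ℝ) (g : (Fin 4 → SpT) → ℂ) (hg : Measurable g) :
    Measurable (convMajor P K σ g) := by
  have hF : Measurable (fun p : (Fin 4 → SpT) × ({μ : Fin 4 // P μ} → SpT) =>
      (∏ μ, ‖K μ (σ μ • p.2 μ)‖ₑ) * ‖g (p.1 - fun μ => if h : P μ then p.2 ⟨μ, h⟩ else 0)‖ₑ) :=
    ((measurable_convKernel K hK σ).comp measurable_snd).mul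
      ((hg.comp (measurable_fst.sub (measurable_extZero.comp measurable_snd))).enorm)
  exact hF.lintegral_prod_right'

/-- **Step 3.** The `L¹–L^∞` slice of the majorant: integrating `convMajor(y)` over the spatial
arguments of all position legs but `μ₀` (leg `μ₀` frozen at `x₀`, momentum legs at `k`) costs at most
`∏_μ ‖K_μ‖_{L¹}` times the supremum over the frozen value of the same slice integral of `|g|` —
Tonelli, the additivity `legIns_sub` of the insertion map, and translation invariance of Lebesgue
measure on the slice. [cite: FeldmanKnorrerTrubowitz2004Ladders, Lemma II.16, proof (p.13 L55–72)] -/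
theorem lintegral_convMajor_legIns_le (i : LegKind) (hP : ∀ μ, P μ → i μ = 1)
    (K : {μ : Fin 4 // P μ} → SpT → ℂ) (hK : ∀ μ, Measurable (K μ))
    (σ : {μ : Fin 4 // P μ} → ℝ) (hσ : ∀ μ, σ μ = 1 ∨ σ μ = -1)
    (g : (Fin 4 → SpT) → ℂ) (hg : Measurable g) (k : Fin 4 → SpT) (μ₀ : Fin 4) (x₀ : SpT) :
    ∫⁻ x : ({μ : Fin 4 // i μ = 1 ∧ μ ≠ μ₀} → SpT), convMajor P K σ g (legIns i k μ₀ x₀ x) ≤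
      (∏ μ, ∫⁻ t, ‖K μ t‖ₑ) *
        ⨆ t : SpT, ∫⁻ x : ({μ : Fin 4 // i μ = 1 ∧ μ ≠ μ₀} → SpT), ‖g (legIns i k μ₀ t x)‖ₑ := by
  haveI := isAddRightInvariant_volume_pi_SpT (ι := {μ : Fin 4 // i μ = 1 ∧ μ ≠ μ₀})
  -- the kernel and the extension by zero
  set Φ : ({μ : Fin 4 // P μ} → SpT) → ℝ≥0∞ := fun w => ∏ μ, ‖K μ (σ μ • w μ)‖ₑ with hΦ
  have hΦm : Measurable Φ := measurable_convKernel K hK σ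
  set ext : ({μ : Fin 4 // P μ} → SpT) → (Fin 4 → SpT) :=
    fun w μ => if h : P μ then w ⟨μ, h⟩ else 0 with hext
  have hextm : Measurable ext := measurable_extZero
  have hext0 : ∀ w μ, i μ = 0 → ext w μ = 0 := by
    intro w μ hμ
    have : ¬ P μ := fun h => by have := hP μ h; omega
    simp [hext, this]
  set S : ℝ≥0∞ := ⨆ t : SpT, ∫⁻ x : ({μ : Fin 4 // i μ = 1 ∧ μ ≠ μ₀} → SpT),
    ‖g (legIns i k μ₀ t x)‖ₑ with hS
  have hmeas : Measurable (Function.uncurry fun (x : {μ : Fin 4 // i μ = 1 ∧ μ ≠ μ₀} → SpT)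
      (w : {μ : Fin 4 // P μ} → SpT) => Φ w * ‖g (legIns i k μ₀ x₀ x - ext w)‖ₑ) := by
    exact (hΦm.comp measurable_snd).mul
      ((hg.comp (((measurable_legIns i k μ₀ x₀).comp measurable_fst).sub
        (hextm.comp measurable_snd))).enorm)
  have hmeas_x : ∀ w : {μ : Fin 4 // P μ} → SpT,
      Measurable fun x : {μ : Fin 4 // i μ = 1 ∧ μ ≠ μ₀} → SpT => ‖g (legIns i k μ₀ x₀ x - ext w)‖ₑ :=
    fun w => (hg.comp ((measurable_legIns i k μ₀ x₀).sub measurable_const)).enorm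
  calc ∫⁻ x : ({μ : Fin 4 // i μ = 1 ∧ μ ≠ μ₀} → SpT), convMajor P K σ g (legIns i k μ₀ x₀ x)
      = ∫⁻ x : ({μ : Fin 4 // i μ = 1 ∧ μ ≠ μ₀} → SpT), ∫⁻ w : ({μ : Fin 4 // P μ} → SpT),
          Φ w * ‖g (legIns i k μ₀ x₀ x - ext w)‖ₑ := rfl
    _ = ∫⁻ w : ({μ : Fin 4 // P μ} → SpT), ∫⁻ x : ({μ : Fin 4 // i μ = 1 ∧ μ ≠ μ₀} → SpT),
          Φ w * ‖g (legIns i k μ₀ x₀ x - ext w)‖ₑ := lintegral_lintegral_swap hmeas.aemeasurable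
    _ = ∫⁻ w : ({μ : Fin 4 // P μ} → SpT), Φ w * ∫⁻ x : ({μ : Fin 4 // i μ = 1 ∧ μ ≠ μ₀} → SpT),
          ‖g (legIns i k μ₀ x₀ x - ext w)‖ₑ := by
        refine lintegral_congr fun w => ?_
        exact lintegral_const_mul _ (hmeas_x w)
    _ ≤ ∫⁻ w : ({μ : Fin 4 // P μ} → SpT), Φ w * S := by
        refine lintegral_mono fun w => ?_
        gcongr
        have h1 : ∫⁻ x : ({μ : Fin 4 // i μ = 1 ∧ μ ≠ μ₀} → SpT), ‖g (legIns i k μ₀ x₀ x - ext w)‖ₑ =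
            ∫⁻ x : ({μ : Fin 4 // i μ = 1 ∧ μ ≠ μ₀} → SpT),
              ‖g (legIns i k μ₀ (x₀ - ext w μ₀) x)‖ₑ := by
          simp_rw [legIns_sub i k μ₀ x₀ _ (ext w) (hext0 w)]
          exact lintegral_sub_right_eq_self
            (fun x : {μ : Fin 4 // i μ = 1 ∧ μ ≠ μ₀} → SpT => ‖g (legIns i k μ₀ (x₀ - ext w μ₀) x)‖ₑ)
            (fun μ => ext w μ.1)
        rw [h1]
        exact le_iSup (fun t : SpT => ∫⁻ x : ({μ : Fin 4 // i μ = 1 ∧ μ ≠ μ₀} → SpT),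
          ‖g (legIns i k μ₀ t x)‖ₑ) (x₀ - ext w μ₀)
    _ = (∫⁻ w : ({μ : Fin 4 // P μ} → SpT), Φ w) * S := lintegral_mul_const S hΦm
    _ = (∏ μ, ∫⁻ t, ‖K μ t‖ₑ) * S := by rw [hΦ, lintegral_convKernel_eq_prod K hK σ hσ]

end Conv


/-! ### §5 The resectorization summand -/

variable (D : LadderData)

/-- The `s'`-summand of `resectFour D jl jr jl' jr' f i · s` (Definition I.18 (ii)–(iii)): new labels `s`,
old labels `s'`; on the position legs whose side changes scale the positions are convolved with
`χ̂_{s_μ}((-1)^{b_μ}(x_μ - x'_μ))` at the new scale, the other legs are untouched.  This is the integral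
of which the proof of Lemma II.16 says "for any fixed `s₁,…,s₄`, there are at most `3⁴` choices of
`(s'₁,…,s'₄)` for which [it] fails to vanish identically" (p.13 L48–53).
[cite: FeldmanKnorrerTrubowitz2004Ladders, Definition I.18 (ii)–(iii) (p.8 L55–93)] -/
def resectTerm (jl jr jl' jr' : ℕ) (f : FourLegFn) (i : LegKind) (s s' : Fin 4 → Arc)
    (y : Fin 4 → SpT) : ℂ :=
  let chg : Fin 4 → Prop := fun μ => i μ = 1 ∧ ((μ.val < 2 ∧ jl' ≠ jl) ∨ (2 ≤ μ.val ∧ jr' ≠ jr))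
  let newScale : Fin 4 → ℕ := fun μ => if μ.val < 2 then jl' else jr'
  ∫ x' : ({μ : Fin 4 // chg μ} → SpT),
    (∏ μ : {μ : Fin 4 // chg μ},
        chiHat (D.χ (newScale μ.1) (s μ.1)) (((-1 : ℝ) ^ bExp μ.1) • (y μ.1 - x' μ))) *
      f i (fun μ => if h : chg μ then x' ⟨μ, h⟩ else y μ) s'

/-- `resectFour` is the sum of `resectTerm` over the old labels (old labels on the legs that change
scale range over the old sectorization, the others are the new labels).
[cite: FeldmanKnorrerTrubowitz2004Ladders, Definition I.18 (ii)–(iii) (p.8 L55–93)] -/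
theorem resectFour_eq_sum_resectTerm (jl jr jl' jr' : ℕ) (f : FourLegFn) (i : LegKind)
    (y : Fin 4 → SpT) (s : Fin 4 → Arc) :
    resectFour D jl jr jl' jr' f i y s =
      ∑ s' ∈ Fintype.piFinset (fun μ : Fin 4 =>
          if i μ = 1 ∧ ((μ.val < 2 ∧ jl' ≠ jl) ∨ (2 ≤ μ.val ∧ jr' ≠ jr))
          then (if μ.val < 2 then D.Sig jl else D.Sig jr) else {s μ}),
        resectTerm D jl jr jl' jr' f i s s' y := rfl

/-- `resectTerm` is a leg-wise convolution term `convTerm` (kernels `χ̂_{s_μ}` at the new scales, signs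
`(-1)^{b_μ}`, acting on `y ↦ f i y s'`). [cite: FeldmanKnorrerTrubowitz2004Ladders, Definition I.18 (ii)–(iii) (p.8 L55–93)] -/
theorem resectTerm_eq_convTerm (jl jr jl' jr' : ℕ) (f : FourLegFn) (i : LegKind)
    (s s' : Fin 4 → Arc) (y : Fin 4 → SpT) :
    resectTerm D jl jr jl' jr' f i s s' y =
      convTerm (fun μ : Fin 4 => i μ = 1 ∧ ((μ.val < 2 ∧ jl' ≠ jl) ∨ (2 ≤ μ.val ∧ jr' ≠ jr)))
        (fun μ => chiHat (D.χ (if μ.1.val < 2 then jl' else jr') (s μ.1)))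
        (fun μ => (-1 : ℝ) ^ bExp μ.1) (fun y => f i y s') y := rfl

/-- The sign `(-1)^{b_μ}` is `±1`. [cite: FeldmanKnorrerTrubowitz2004Ladders, (I.4) (p.5 L56–64)] -/
theorem neg_one_pow_bExp (μ : Fin 4) : ((-1 : ℝ) ^ bExp μ) = 1 ∨ ((-1 : ℝ) ^ bExp μ) = -1 := by
  unfold bExp
  split_ifs <;> simp

/-- The `δ = 0` instance of `ChiDecayBound`: `‖χ̂_s‖_{L¹} ≤ cst` for `s ∈ Σ_j`, `j ≥ 1`.
[cite: FeldmanKnorrerTrubowitz2004Ladders, §I.7 (p.8 L29–33) and (p.13 L91–96)] -/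
theorem lintegral_enorm_chiHat_le_of_chiDecayBound {D : LadderData} {cst : ℝ}
    (hχ : ChiDecayBound D cst) {j : ℕ} (hj : 1 ≤ j) {a : Arc} (ha : a ∈ D.Sig j) :
    ∫⁻ x, ‖chiHat (D.χ j a) x‖ₑ ≤ ENNReal.ofReal cst := by
  have h := hχ j hj a ha 0 (by simp [DeltaSet])
  have h1 : multiFactorial 0 = 1 := by simp [multiFactorial]
  have h2 : ∀ x : SpT, monomial 0 x = 1 := by intro x; simp [monomial]
  have h3 : multiDeg 0 = 0 := by simp [multiDeg]
  simp only [h1, h2, h3, Nat.cast_one, inv_one, one_mul, Complex.ofReal_one, mul_zero, pow_zero,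
    mul_one] at h
  simpa only [enorm_eq_nnnorm] using h

/-- No differential–decay operator at multi-index `0`. [cite: FeldmanKnorrerTrubowitz2004Ladders, Definition I.12 (p.7 L21–41)] -/
theorem diffDecay_zero (i : LegKind) (μ μ' : Fin 4) (g : (Fin 4 → SpT) → ℂ) :
    diffDecay i μ μ' 0 g = g := by
  simp [diffDecay]

/-! ### §6 Lemma II.16 at `δ⃗ = 0`, one leg-kind component, modulo the sector geometry -/

/-- **Lemma II.16 (`\lemLADresectornorm`) — the analytic core, component by component, at
`δ⃗ = (0,0,0)`.**  Let `1 ≤ l' ≤ l`, `1 ≤ r' ≤ r`, let `i` be a leg-kind vector with at least one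
position leg, and let `f i` be (Borel) measurable in its continuous arguments for every label
assignment.  ASSUME the sector geometry in the following form: a neighbour map `N` assigning to every
leg `μ` and new label `a` a set `N μ a` of at most `3` old labels, such that the `s'`-summand
`resectTerm D l' r' l r f i s s'` of the resectorization vanishes identically as soon as, on some
position leg `μ` that changes scale, the old label `s' μ` is not in `N μ (s μ)` (in print: "`f` is
sectorized and `ℓ' < ℓ`, `r' < r`" — `χ̂_{s_μ} * ` a function Fourier-supported in `s̃'_μ` vanishes
unless `s̃_μ ∩ s̃'_μ ≠ ∅`, and at most three old sectors meet a new one; these two inputs are NOT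
proved here).  THEN the `(0,0,0)`-coefficient of the `Σ_l,Σ_r`-norm of the `i`-component of
`f_{Σ_l,Σ_r}` is at most `3⁴ · max(1,cst)⁴` times that of `f` on `Σ_{l'},Σ_{r'}`, `cst` being the
constant of `ChiDecayBound` (`‖χ̂_s‖_{L¹} ≤ cst`).  This is the displayed computation p.13 L55–72
with `α = β = 0`: `|∫ ∏ χ̂ f| ≤ ∫ ∏ |χ̂| |f|`, Tonelli, `∫ dx_ν |χ̂_{s_ν}(x_ν - x'_ν)| = ‖χ̂_{s_ν}‖_{L¹}`,
and the count of surviving old labels.  The measurability hypothesis is necessary for this route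
(iterated lower Lebesgue integrals of non-measurable integrands need not commute); the printed lemma
concerns (smooth) sectorized functions, the tree's `ResectorizationNormBound` quantifies over all
`f : FourLegFn` and is not touched here.
[cite: FeldmanKnorrerTrubowitz2004Ladders, Lemma II.16 (p.13 L19–33), proof p.13 L37–72] -/
theorem legNorm_resectFour_le_of_neighbours {cst : ℝ} (hχ : ChiDecayBound D cst)
    {l l' r r' : ℕ} (hl' : 1 ≤ l') (hl : l' ≤ l) (hr' : 1 ≤ r') (hr : r' ≤ r)
    (i : LegKind) (hi : ∃ μ, i μ = 1)
    (f : FourLegFn) (hf : ∀ s' : Fin 4 → Arc, Measurable fun y : Fin 4 → SpT => f i y s')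
    (N : Fin 4 → Arc → Finset Arc) (hN : ∀ μ a, (N μ a).card ≤ 3)
    (hvan : ∀ s s' : Fin 4 → Arc, AdmissibleLabels (D.Sig l) (D.Sig r) i s →
      AdmissibleLabels (D.Sig l') (D.Sig r') i s' →
      (∃ μ : Fin 4, (i μ = 1 ∧ ((μ.val < 2 ∧ l ≠ l') ∨ (2 ≤ μ.val ∧ r ≠ r'))) ∧ s' μ ∉ N μ (s μ)) →
      ∀ y, resectTerm D l' r' l r f i s s' y = 0) :
    legNorm (D.Sig l) (D.Sig r) i 0 0 0 (resectFour D l' r' l r f i) ≤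
      3 ^ 4 * ENNReal.ofReal (max 1 cst) ^ 4 * legNorm (D.Sig l') (D.Sig r') i 0 0 0 (f i) := by
  have hdd : ∀ (μ μ' : Fin 4) (g : (Fin 4 → SpT) → ℂ), diffDecay i μ μ' 0 g = g :=
    fun μ μ' g => diffDecay_zero i μ μ' g
  set R := legNorm (D.Sig l') (D.Sig r') i 0 0 0 (f i) with hR
  set c₁ : ℝ≥0∞ := ENNReal.ofReal (max 1 cst) with hc₁
  have hc₁1 : 1 ≤ c₁ := by
    rw [hc₁, ← ENNReal.ofReal_one]
    exact ENNReal.ofReal_le_ofReal (le_max_left _ _)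
  unfold legNorm
  simp only [hdd]
  refine iSup₂_le fun s hs => iSup_le fun k => iSup₂_le fun μ _ => iSup₂_le fun μ' _ => ?_
  rw [l1linfLegs_eq_iSup i _ k hi]
  refine iSup_le fun μ₀ => iSup_le fun x₀ => ?_
  -- (a) the slice of `|f(·, s')|` is dominated by the old norm, for admissible old labels
  have hS : ∀ s' : Fin 4 → Arc, AdmissibleLabels (D.Sig l') (D.Sig r') i s' →
      (⨆ t : SpT, ∫⁻ x : ({μ : Fin 4 // i μ = 1 ∧ μ ≠ μ₀.1} → SpT),
        ‖f i (legIns i k μ₀.1 t x) s'‖ₑ) ≤ R := by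
    intro s' hs'
    rw [hR, legNorm]
    refine le_iSup₂_of_le s' hs' (le_iSup_of_le k (le_iSup₂_of_le 0 (Or.inl rfl)
      (le_iSup₂_of_le 2 (Or.inl rfl) ?_)))
    rw [hdd, hdd, hdd, l1linfLegs_eq_iSup i _ k hi]
    exact le_iSup_of_le μ₀ le_rfl
  -- (b) `‖χ̂_{s_μ}‖_{L¹} ≤ max(1,cst)` on the legs that change scale
  have hK : ∀ μ : Fin 4, i μ = 1 ∧ ((μ.val < 2 ∧ l ≠ l') ∨ (2 ≤ μ.val ∧ r ≠ r')) →
      ∫⁻ t, ‖chiHat (D.χ (if μ.val < 2 then l else r) (s μ)) t‖ₑ ≤ c₁ := by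
    intro μ hμ
    have h1 := (hs μ).1 hμ.1
    have hsc : 1 ≤ (if μ.val < 2 then l else r) ∧ s μ ∈ D.Sig (if μ.val < 2 then l else r) := by
      split_ifs with hlt
      · exact ⟨hl'.trans hl, h1.1 hlt⟩
      · exact ⟨hr'.trans hr, h1.2 (by omega)⟩
    exact (lintegral_enorm_chiHat_le_of_chiDecayBound hχ hsc.1 hsc.2).trans
      (ENNReal.ofReal_le_ofReal (le_max_right _ _))
  -- (c) the boxes of old labels: all of them, and the surviving ones
  set oldBox : Fin 4 → Finset Arc := fun μ =>
    if i μ = 1 ∧ ((μ.val < 2 ∧ l ≠ l') ∨ (2 ≤ μ.val ∧ r ≠ r'))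
    then (if μ.val < 2 then D.Sig l' else D.Sig r') else {s μ} with holdBox
  set redBox : Fin 4 → Finset Arc := fun μ =>
    if i μ = 1 ∧ ((μ.val < 2 ∧ l ≠ l') ∨ (2 ≤ μ.val ∧ r ≠ r'))
    then (if μ.val < 2 then D.Sig l' else D.Sig r') ∩ N μ (s μ) else {s μ} with hredBox
  have hsum : ∀ y, resectFour D l' r' l r f i y s =
      ∑ s' ∈ Fintype.piFinset oldBox, resectTerm D l' r' l r f i s s' y :=
    fun y => resectFour_eq_sum_resectTerm D l' r' l r f i y s
  have hsub : Fintype.piFinset redBox ⊆ Fintype.piFinset oldBox := by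
    refine Fintype.piFinset_subset _ _ fun μ => ?_
    simp only [hredBox, holdBox]
    split_ifs <;> first
      | exact Finset.inter_subset_left
      | exact Finset.Subset.refl _
  have hadm_old : ∀ s' ∈ Fintype.piFinset oldBox, AdmissibleLabels (D.Sig l') (D.Sig r') i s' := by
    intro s' hs' μ
    rw [Fintype.mem_piFinset] at hs'
    have hμ := hs' μ
    simp only [holdBox] at hμ
    refine ⟨fun hi1 => ?_, fun hi0 => ?_⟩
    · by_cases hc : (μ.val < 2 ∧ l ≠ l') ∨ (2 ≤ μ.val ∧ r ≠ r')
      · rw [if_pos ⟨hi1, hc⟩] at hμ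
        refine ⟨fun hlt => ?_, fun hge => ?_⟩
        · simpa [hlt] using hμ
        · have hnlt : ¬ μ.val < 2 := by omega
          simpa [hnlt] using hμ
      · rw [if_neg (fun h => hc h.2), Finset.mem_singleton] at hμ
        rw [hμ]
        have h1 := (hs μ).1 hi1
        push Not at hc
        refine ⟨fun hlt => ?_, fun hge => ?_⟩
        · rw [← hc.1 hlt]; exact h1.1 hlt
        · rw [← hc.2 hge]; exact h1.2 hge
    · have hc : ¬ (i μ = 1 ∧ ((μ.val < 2 ∧ l ≠ l') ∨ (2 ≤ μ.val ∧ r ≠ r'))) := fun h => by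
        have := h.1; omega
      rw [if_neg hc, Finset.mem_singleton] at hμ
      rw [hμ]
      exact (hs μ).2 hi0
  have hcard : (Fintype.piFinset redBox).card ≤ 3 ^ 4 := by
    rw [Fintype.card_piFinset]
    have h3 : ∀ μ, (redBox μ).card ≤ 3 := by
      intro μ
      simp only [hredBox]
      split_ifs <;> first
        | exact (Finset.card_le_card Finset.inter_subset_right).trans (hN μ (s μ))
        | (rw [Finset.card_singleton]; omega)
    calc ∏ μ, (redBox μ).card ≤ ∏ _μ : Fin 4, 3 := Finset.prod_le_prod' fun μ _ => h3 μ
      _ = 3 ^ 4 := by simp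
  -- (d) the pointwise bound: drop the vanishing summands, bound each survivor by its majorant
  have hpt : ∀ y : Fin 4 → SpT, ‖resectFour D l' r' l r f i y s‖ₑ ≤
      ∑ s' ∈ Fintype.piFinset redBox,
        convMajor (fun μ : Fin 4 => i μ = 1 ∧ ((μ.val < 2 ∧ l ≠ l') ∨ (2 ≤ μ.val ∧ r ≠ r')))
          (fun μ => chiHat (D.χ (if μ.1.val < 2 then l else r) (s μ.1)))
          (fun μ => (-1 : ℝ) ^ bExp μ.1) (fun y => f i y s') y := by
    intro y
    rw [hsum y, ← Finset.sum_subset hsub ?_]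
    · refine (enorm_sum_le _ _).trans (Finset.sum_le_sum fun s' _ => ?_)
      rw [resectTerm_eq_convTerm]
      exact enorm_convTerm_le_convMajor _ _ _ _
    · intro s' hs'old hs'red
      apply hvan s s' hs (hadm_old s' hs'old)
      rw [Fintype.mem_piFinset] at hs'old hs'red
      push Not at hs'red
      obtain ⟨μ, hμ⟩ := hs'red
      have hμold := hs'old μ
      simp only [holdBox] at hμold
      simp only [hredBox] at hμ
      by_cases hc : i μ = 1 ∧ ((μ.val < 2 ∧ l ≠ l') ∨ (2 ≤ μ.val ∧ r ≠ r'))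
      · rw [if_pos hc] at hμold hμ
        exact ⟨μ, hc, fun hN' => hμ (Finset.mem_inter.mpr ⟨hμold, hN'⟩)⟩
      · rw [if_neg hc] at hμold hμ
        exact absurd hμold hμ
  -- (e) integrate the pointwise bound over the slice and use the analytic core
  calc ∫⁻ x : ({μ : Fin 4 // i μ = 1 ∧ μ ≠ μ₀.1} → SpT),
        ‖resectFour D l' r' l r f i (legIns i k μ₀.1 x₀ x) s‖ₑ
      ≤ ∫⁻ x : ({μ : Fin 4 // i μ = 1 ∧ μ ≠ μ₀.1} → SpT), ∑ s' ∈ Fintype.piFinset redBox,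
          convMajor (fun μ : Fin 4 => i μ = 1 ∧ ((μ.val < 2 ∧ l ≠ l') ∨ (2 ≤ μ.val ∧ r ≠ r')))
            (fun μ => chiHat (D.χ (if μ.1.val < 2 then l else r) (s μ.1)))
            (fun μ => (-1 : ℝ) ^ bExp μ.1) (fun y => f i y s') (legIns i k μ₀.1 x₀ x) :=
        lintegral_mono fun x => hpt _
    _ = ∑ s' ∈ Fintype.piFinset redBox, ∫⁻ x : ({μ : Fin 4 // i μ = 1 ∧ μ ≠ μ₀.1} → SpT),
          convMajor (fun μ : Fin 4 => i μ = 1 ∧ ((μ.val < 2 ∧ l ≠ l') ∨ (2 ≤ μ.val ∧ r ≠ r')))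
            (fun μ => chiHat (D.χ (if μ.1.val < 2 then l else r) (s μ.1)))
            (fun μ => (-1 : ℝ) ^ bExp μ.1) (fun y => f i y s') (legIns i k μ₀.1 x₀ x) := by
        refine lintegral_finsetSum _ fun s' _ => ?_
        exact (measurable_convMajor _ (fun μ => measurable_chiHat _) _ _ (hf s')).comp
          (measurable_legIns i k μ₀.1 x₀)
    _ ≤ ∑ s' ∈ Fintype.piFinset redBox, c₁ ^ 4 * R := by
        refine Finset.sum_le_sum fun s' hs' => ?_
        refine (lintegral_convMajor_legIns_le i (fun μ h => h.1) _ (fun μ => measurable_chiHat _)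
          _ (fun μ => neg_one_pow_bExp μ.1) _ (hf s') k μ₀.1 x₀).trans ?_
        refine mul_le_mul' ?_ (hS s' (hadm_old s' (hsub hs')))
        calc ∏ μ : {μ : Fin 4 // i μ = 1 ∧ ((μ.val < 2 ∧ l ≠ l') ∨ (2 ≤ μ.val ∧ r ≠ r'))},
              ∫⁻ t, ‖chiHat (D.χ (if μ.1.val < 2 then l else r) (s μ.1)) t‖ₑ
            ≤ ∏ _μ : {μ : Fin 4 // i μ = 1 ∧ ((μ.val < 2 ∧ l ≠ l') ∨ (2 ≤ μ.val ∧ r ≠ r'))}, c₁ :=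
              Finset.prod_le_prod' fun μ _ => hK μ.1 μ.2
          _ = c₁ ^ Fintype.card
                {μ : Fin 4 // i μ = 1 ∧ ((μ.val < 2 ∧ l ≠ l') ∨ (2 ≤ μ.val ∧ r ≠ r'))} := by
              simp
          _ ≤ c₁ ^ 4 := pow_le_pow_right₀ hc₁1 ((Fintype.card_subtype_le _).trans (by simp))
    _ = (Fintype.piFinset redBox).card * (c₁ ^ 4 * R) := by
        simp [Finset.sum_const, nsmul_eq_mul]
    _ ≤ 3 ^ 4 * (c₁ ^ 4 * R) := by
        gcongr
        exact_mod_cast hcard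
    _ = 3 ^ 4 * c₁ ^ 4 * R := (mul_assoc _ _ _).symm


/-! ### §7 The components without position legs; the `δ⃗ = 0` norms of Definitions II.13/II.15; the summed bounds -/

/-- With no leg to convolve, the leg-wise convolution term is the function itself. [folklore] -/
private theorem convTerm_of_forall_not {P : Fin 4 → Prop} [DecidablePred P] (hP : ∀ μ, ¬ P μ)
    (K : {μ : Fin 4 // P μ} → SpT → ℂ) (σ : {μ : Fin 4 // P μ} → ℝ) (g : (Fin 4 → SpT) → ℂ)
    (y : Fin 4 → SpT) : convTerm P K σ g y = g y := by
  haveI : IsEmpty {μ : Fin 4 // P μ} := ⟨fun μ => hP μ.1 μ.2⟩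
  unfold convTerm
  have h1 : ∀ x' : {μ : Fin 4 // P μ} → SpT,
      (∏ μ, K μ (σ μ • (y μ.1 - x' μ))) * g (fun μ => if h : P μ then x' ⟨μ, h⟩ else y μ) = g y := by
    intro x'
    rw [Finset.univ_eq_empty, Finset.prod_empty, one_mul]
    congr 1
    funext μ
    rw [dif_neg (hP μ)]
  simp_rw [h1]
  have huniv : (volume : Measure ({μ : Fin 4 // P μ} → SpT)) Set.univ = 1 := by
    rw [volume_pi, Measure.pi_univ]
    simp
  rw [integral_const, Measure.real, huniv]
  simp

/-- On a leg-kind vector without position legs resectorization does nothing (Definition I.18: only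
position legs are resectorized). [cite: FeldmanKnorrerTrubowitz2004Ladders, Definition I.18 (ii)–(iii) (p.8 L55–93)] -/
theorem resectFour_eq_self_of_noPos (jl jr jl' jr' : ℕ) (f : FourLegFn) (i : LegKind)
    (hi : ∀ μ, i μ = 0) (y : Fin 4 → SpT) (s : Fin 4 → Arc) :
    resectFour D jl jr jl' jr' f i y s = f i y s := by
  rw [resectFour_eq_sum_resectTerm]
  have hnot : ∀ μ : Fin 4, ¬ (i μ = 1 ∧ ((μ.val < 2 ∧ jl' ≠ jl) ∨ (2 ≤ μ.val ∧ jr' ≠ jr))) := by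
    intro μ h
    have := hi μ
    omega
  have hbox : (fun μ : Fin 4 => if i μ = 1 ∧ ((μ.val < 2 ∧ jl' ≠ jl) ∨ (2 ≤ μ.val ∧ jr' ≠ jr))
      then (if μ.val < 2 then D.Sig jl else D.Sig jr) else {s μ}) = fun μ => {s μ} :=
    funext fun μ => if_neg (hnot μ)
  have hpi : Fintype.piFinset (fun μ : Fin 4 => ({s μ} : Finset Arc)) = {s} := by
    ext s'
    simp only [Fintype.mem_piFinset, Finset.mem_singleton]
    exact ⟨fun h => funext h, fun h μ => by rw [h]⟩
  rw [hbox, hpi, Finset.sum_singleton, resectTerm_eq_convTerm, convTerm_of_forall_not hnot]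

/-- On a leg-kind vector without position legs the admissible labels do not depend on the
sectorizations (momentum legs carry the dummy label). [cite: FeldmanKnorrerTrubowitz2004Ladders, Definition I.13 (i) (p.7 L43–59)] -/
theorem admissibleLabels_iff_of_noPos (Γl Γr Γl' Γr' : Finset Arc) (i : LegKind)
    (hi : ∀ μ, i μ = 0) (s : Fin 4 → Arc) :
    AdmissibleLabels Γl Γr i s ↔ AdmissibleLabels Γl' Γr' i s := by
  unfold AdmissibleLabels
  constructor
  · intro h μ
    exact ⟨fun h1 => by have := hi μ; omega, (h μ).2⟩
  · intro h μ
    exact ⟨fun h1 => by have := hi μ; omega, (h μ).2⟩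

/-- Hence on such a leg-kind vector the norm of Definition I.13 (i) does not depend on the
sectorizations either. [cite: FeldmanKnorrerTrubowitz2004Ladders, Definition I.13 (i) (p.7 L43–59)] -/
theorem legNorm_eq_of_noPos (Γl Γr Γl' Γr' : Finset Arc) (i : LegKind) (hi : ∀ μ, i μ = 0)
    (δl δc δr : Fin 3 → ℕ) (g : (Fin 4 → SpT) → (Fin 4 → Arc) → ℂ) :
    legNorm Γl Γr i δl δc δr g = legNorm Γl' Γr' i δl δc δr g := by
  unfold legNorm
  simp_rw [admissibleLabels_iff_of_noPos Γl Γr Γl' Γr' i hi]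

/-- The constant `3⁴ · max(1,cst)⁴` is at least one. [folklore] -/
private theorem one_le_resectConst (cst : ℝ) : (1 : ℝ≥0∞) ≤ 3 ^ 4 * ENNReal.ofReal (max 1 cst) ^ 4 := by
  have hc : 1 ≤ ENNReal.ofReal (max 1 cst) := by
    rw [← ENNReal.ofReal_one]
    exact ENNReal.ofReal_le_ofReal (le_max_left _ _)
  calc (1 : ℝ≥0∞) = 1 * 1 := (one_mul 1).symm
    _ ≤ 3 ^ 4 * ENNReal.ofReal (max 1 cst) ^ 4 :=
        mul_le_mul' (one_le_pow₀ (by norm_num)) (one_le_pow₀ hc)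

/-- The components without position legs satisfy the bound of `legNorm_resectFour_le_of_neighbours`
trivially (resectorization is the identity there and the constant is `≥ 1`). [cite: FeldmanKnorrerTrubowitz2004Ladders, Lemma II.16 (p.13 L19–33)] -/
theorem legNorm_resectFour_le_of_noPos (cst : ℝ) (l l' r r' : ℕ) (i : LegKind) (hi : ∀ μ, i μ = 0)
    (f : FourLegFn) :
    legNorm (D.Sig l) (D.Sig r) i 0 0 0 (resectFour D l' r' l r f i) ≤
      3 ^ 4 * ENNReal.ofReal (max 1 cst) ^ 4 * legNorm (D.Sig l') (D.Sig r') i 0 0 0 (f i) := by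
  have h1 : resectFour D l' r' l r f i = f i :=
    funext fun y => funext fun s => resectFour_eq_self_of_noPos D l' r' l r f i hi y s
  rw [h1, legNorm_eq_of_noPos (D.Sig l) (D.Sig r) (D.Sig l') (D.Sig r') i hi]
  exact le_mul_of_one_le_left zero_le (one_le_resectConst cst)

/-- At `δ⃗ = 0` the scaled norm of Definition II.13 is the plain coefficient `‖·‖^{(0,0,0)}_{Σ_l,Σ_r}`
(no power of `M`). [cite: FeldmanKnorrerTrubowitz2004Ladders, Definition II.13 (p.12 L117–122)] -/
theorem scaledNorm_zero (l r : ℕ) (g : FourLegFn) :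
    scaledNorm D l r 0 0 0 g = fourNormCoeff (D.Sig l) (D.Sig r) 0 0 0 g := by
  unfold scaledNorm
  simp [multiDeg]

/-- At `δ⃗ = 0` the max-norm `|·|^{[0,0,0]}_{l,r}` of Definition II.13 is the plain coefficient
`‖·‖^{(0,0,0)}_{Σ_l,Σ_r}`. [cite: FeldmanKnorrerTrubowitz2004Ladders, Definition II.13 (p.12 L123–129)] -/
theorem scaledNormMax_zero (l r : ℕ) (g : FourLegFn) :
    scaledNormMax D l r 0 0 0 g = fourNormCoeff (D.Sig l) (D.Sig r) 0 0 0 g := by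
  unfold scaledNormMax
  apply le_antisymm
  · refine iSup₂_le fun δl' hl => iSup₂_le fun δc' hc => iSup₂_le fun δr' hr => ?_
    have e1 : δl' = 0 := funext fun c => Nat.le_zero.mp (hl c)
    have e2 : δc' = 0 := funext fun c => Nat.le_zero.mp (hc c)
    have e3 : δr' = 0 := funext fun c => Nat.le_zero.mp (hr c)
    subst e1 e2 e3
    rw [scaledNorm_zero]
  · refine le_iSup₂_of_le 0 le_rfl (le_iSup₂_of_le 0 le_rfl (le_iSup₂_of_le 0 le_rfl ?_))
    rw [scaledNorm_zero]

/-- **Lemma II.16 at `δ⃗ = 0` (second inequality), modulo the sector geometry**: for `1 ≤ l' ≤ l`,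
`1 ≤ r' ≤ r`, a four-legged function `f` all of whose components are Borel measurable in their
continuous arguments, and a neighbour map `N` (at most three old labels per leg and new label) outside
of which the resectorization summands vanish identically (the two sector-geometry inputs of the printed
proof, taken as hypotheses — see `legNorm_resectFour_le_of_neighbours`),
`|f|^{[0,0,0]}_{l,r} = |f_{Σ_l,Σ_r}|^{[0,0,0]}_{l,r} ≤ 3⁴ · max(1,cst)⁴ · |f|^{[0,0,0]}_{l',r'}` with `cst`
the constant of `ChiDecayBound`; i.e. the printed `|f|^{[δ⃗]}_{ℓ,r} ≤ const |f|^{[δ⃗]}_{ℓ',r'}` in the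
derivative-free case, with an explicit constant.  Summed from the sixteen leg-kind components
(`legNorm_resectFour_le_of_neighbours` for components with a position leg,
`legNorm_resectFour_le_of_noPos` for the all-momentum component).
[cite: FeldmanKnorrerTrubowitz2004Ladders, Lemma II.16 (p.13 L19–33), proof p.13 L37–72] -/
theorem resectScaledNormMax_zero_le_of_neighbours {cst : ℝ} (hχ : ChiDecayBound D cst)
    {l l' r r' : ℕ} (hl' : 1 ≤ l') (hl : l' ≤ l) (hr' : 1 ≤ r') (hr : r' ≤ r)
    (f : FourLegFn) (hf : ∀ (i : LegKind) (s' : Fin 4 → Arc), Measurable fun y : Fin 4 → SpT => f i y s')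
    (N : Fin 4 → Arc → Finset Arc) (hN : ∀ μ a, (N μ a).card ≤ 3)
    (hvan : ∀ (i : LegKind) (s s' : Fin 4 → Arc), AdmissibleLabels (D.Sig l) (D.Sig r) i s →
      AdmissibleLabels (D.Sig l') (D.Sig r') i s' →
      (∃ μ : Fin 4, (i μ = 1 ∧ ((μ.val < 2 ∧ l ≠ l') ∨ (2 ≤ μ.val ∧ r ≠ r'))) ∧ s' μ ∉ N μ (s μ)) →
      ∀ y, resectTerm D l' r' l r f i s s' y = 0) :
    resectScaledNormMax D l' r' l r 0 0 0 f ≤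
      3 ^ 4 * ENNReal.ofReal (max 1 cst) ^ 4 * scaledNormMax D l' r' 0 0 0 f := by
  unfold resectScaledNormMax
  rw [scaledNormMax_zero, scaledNormMax_zero]
  unfold fourNormCoeff
  rw [Finset.mul_sum]
  refine Finset.sum_le_sum fun i _ => ?_
  by_cases hi : ∃ μ, i μ = 1
  · exact legNorm_resectFour_le_of_neighbours D hχ hl' hl hr' hr i hi f (hf i) N hN (hvan i)
  · push Not at hi
    have hi0 : ∀ μ, i μ = 0 := fun μ => by have := hi μ; omega
    exact legNorm_resectFour_le_of_noPos D cst l l' r r' i hi0 f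


/-! ### §7 (continued) With the sector count of `FKTLaddersSectorCounting`: modulo support vanishing only -/

/-- **Lemma II.16 at `δ⃗ = 0`, modulo the Fourier-support step only.**  For admissible ladder data the
neighbour map of `resectScaledNormMax_zero_le_of_neighbours` is instantiated with
`N μ a = {b ∈ Σ_old(μ) : ã ∩ b̃ ≠ ∅}` (old scale `l'` on legs `0,1`, `r'` on legs `2,3`), which has at
most three elements by the sector count `card_filter_extSector_inter_nonempty_le_three`
(`FKTLaddersSectorCounting`, the geometric half of "at most `3⁴` choices of `s'`", p.13 L48–53).  What
remains as a hypothesis is the analytic half of that sentence: the `s'`-summand `resectTerm` vanishes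
identically when, on some position leg `μ` that changes scale, the new and old extended sectors are
disjoint, `s̃_μ ∩ s̃'_μ = ∅` ("because `f` is sectorized") — to be supplied for the sectorized, translation
invariant `f` of the Lemma (with the leg-integrability that makes `totalFT` an honest Fourier
transform) by the companion on support vanishing.  Conclusion:
`|f|^{[0,0,0]}_{l,r} ≤ 3⁴ · max(1,cst)⁴ · |f|^{[0,0,0]}_{l',r'}`.
[cite: FeldmanKnorrerTrubowitz2004Ladders, Lemma II.16 (p.13 L19–33), proof p.13 L37–72] -/
theorem resectScaledNormMax_zero_le_of_support (hD : D.Admissible) {cst : ℝ}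
    (hχ : ChiDecayBound D cst) {l l' r r' : ℕ} (hl' : 1 ≤ l') (hl : l' ≤ l) (hr' : 1 ≤ r')
    (hr : r' ≤ r) (f : FourLegFn)
    (hf : ∀ (i : LegKind) (s' : Fin 4 → Arc), Measurable fun y : Fin 4 → SpT => f i y s')
    (hsupp : ∀ (i : LegKind) (s s' : Fin 4 → Arc) (μ : Fin 4),
      AdmissibleLabels (D.Sig l) (D.Sig r) i s → AdmissibleLabels (D.Sig l') (D.Sig r') i s' →
      i μ = 1 → ((μ.val < 2 ∧ l ≠ l') ∨ (2 ≤ μ.val ∧ r ≠ r')) →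
      ¬ (extSector D.S D.e D.fr (if μ.val < 2 then l else r) (s μ) ∩
          extSector D.S D.e D.fr (if μ.val < 2 then l' else r') (s' μ)).Nonempty →
      ∀ y, resectTerm D l' r' l r f i s s' y = 0) :
    resectScaledNormMax D l' r' l r 0 0 0 f ≤
      3 ^ 4 * ENNReal.ofReal (max 1 cst) ^ 4 * scaledNormMax D l' r' 0 0 0 f := by
  classical
  -- the neighbour map: old sectors whose extension meets the extension of the new sector `a`
  let N : Fin 4 → Arc → Finset Arc := fun μ a =>
    if a ∈ D.Sig (if μ.val < 2 then l else r) then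
      (if μ.val < 2 then D.Sig l' else D.Sig r').filter fun b =>
        (extSector D.S D.e D.fr (if μ.val < 2 then l else r) a ∩
          extSector D.S D.e D.fr (if μ.val < 2 then l' else r') b).Nonempty
    else ∅
  refine resectScaledNormMax_zero_le_of_neighbours D hχ hl' hl hr' hr f hf N ?_ ?_
  · intro μ a
    by_cases ha : a ∈ D.Sig (if μ.val < 2 then l else r)
    · simp only [N, if_pos ha]
      by_cases hμ : μ.val < 2
      · simp only [hμ, if_true] at ha ⊢
        exact card_filter_extSector_inter_nonempty_le_three D hD hl' hl ha
      · simp only [hμ, if_false] at ha ⊢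
        exact card_filter_extSector_inter_nonempty_le_three D hD hr' hr ha
    · simp only [N, if_neg ha, Finset.card_empty]
      omega
  · rintro i s s' hs hs' ⟨μ, ⟨hi1, hc⟩, hN⟩ y
    refine hsupp i s s' μ hs hs' hi1 hc ?_ y
    intro hne
    apply hN
    have hsμ : s μ ∈ D.Sig (if μ.val < 2 then l else r) := by
      have h1 := (hs μ).1 hi1
      split_ifs with hμ
      · exact h1.1 hμ
      · exact h1.2 (by omega)
    have hs'μ : s' μ ∈ (if μ.val < 2 then D.Sig l' else D.Sig r') := by
      have h1 := (hs' μ).1 hi1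
      split_ifs with hμ
      · exact h1.1 hμ
      · exact h1.2 (by omega)
    simp only [N, if_pos hsμ]
    exact Finset.mem_filter.mpr ⟨hs'μ, hne⟩


/-! ### §8 Finiteness of the old norm gives slice integrability; the bound with that input exposed -/

/-- Every slice integral entering `‖f|_i‖^{(0,0,0)}_{Σ_{l'},Σ_{r'}}` (Definition I.13 (i): labels `s'`
admissible, momenta `k`, a position leg `μ₀` frozen at `t`, the other position legs integrated) is
dominated by `|f|^{[0,0,0]}_{l',r'}`. [cite: FeldmanKnorrerTrubowitz2004Ladders, Definition I.13 (p.7 L43–68) and Definition II.13 (p.12 L117–129)] -/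
theorem lintegral_slice_le_scaledNormMax_zero (l' r' : ℕ) (f : FourLegFn) (i : LegKind)
    (s' : Fin 4 → Arc) (hs' : AdmissibleLabels (D.Sig l') (D.Sig r') i s') (k : Fin 4 → SpT)
    (μ₀ : Fin 4) (hμ₀ : i μ₀ = 1) (t : SpT) :
    ∫⁻ x : ({μ : Fin 4 // i μ = 1 ∧ μ ≠ μ₀} → SpT), ‖f i (legIns i k μ₀ t x) s'‖ₑ ≤
      scaledNormMax D l' r' 0 0 0 f := by
  rw [scaledNormMax_zero]
  unfold fourNormCoeff
  refine le_trans ?_ (Finset.single_le_sum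
    (f := fun i => legNorm (D.Sig l') (D.Sig r') i 0 0 0 (f i)) (fun _ _ => zero_le) (Finset.mem_univ i))
  unfold legNorm
  simp only [diffDecay_zero]
  refine le_iSup₂_of_le s' hs' (le_iSup_of_le k (le_iSup₂_of_le 0 (Or.inl rfl)
    (le_iSup₂_of_le 2 (Or.inl rfl) ?_)))
  rw [l1linfLegs_eq_iSup i _ k ⟨μ₀, hμ₀⟩]
  exact le_iSup_of_le ⟨μ₀, hμ₀⟩ (le_iSup_of_le t le_rfl)

/-- **Leg-integrability from finiteness of the norm.**  If `|f|^{[0,0,0]}_{l',r'} < ∞` and the component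
`f|_i(·, s')` is measurable, then every slice of it (one position leg frozen, momentum legs frozen, the
remaining position legs as variables) is integrable — the hypothesis under which the total Fourier
transform `totalFT` of Definition I.5 (ii) is an honest Fourier transform and the support-vanishing
step of Lemma II.16's proof applies (for `|f| = ∞` the Lemma is trivial).
[cite: FeldmanKnorrerTrubowitz2004Ladders, Definition I.13 (p.7 L43–68) and Lemma II.16 (p.13 L19–33)] -/
theorem integrable_slice_of_scaledNormMax_ne_top (l' r' : ℕ) (f : FourLegFn)
    (hfin : scaledNormMax D l' r' 0 0 0 f ≠ ⊤) (i : LegKind) (s' : Fin 4 → Arc)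
    (hs' : AdmissibleLabels (D.Sig l') (D.Sig r') i s')
    (hf : Measurable fun y : Fin 4 → SpT => f i y s') (k : Fin 4 → SpT) (μ₀ : Fin 4)
    (hμ₀ : i μ₀ = 1) (t : SpT) :
    Integrable (fun x : ({μ : Fin 4 // i μ = 1 ∧ μ ≠ μ₀} → SpT) => f i (legIns i k μ₀ t x) s') := by
  refine ⟨(hf.comp (measurable_legIns i k μ₀ t)).aestronglyMeasurable, ?_⟩
  exact lt_of_le_of_lt (lintegral_slice_le_scaledNormMax_zero D l' r' f i s' hs' k μ₀ hμ₀ t)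
    (lt_top_iff_ne_top.2 hfin)

/-- **Lemma II.16 at `δ⃗ = 0`, modulo support vanishing in the finite case only.**  As
`resectScaledNormMax_zero_le_of_support`, but the support-vanishing input may assume
`|f|^{[0,0,0]}_{l',r'} < ∞` (hence, by `integrable_slice_of_scaledNormMax_ne_top`, the
leg-integrability of every component slice); when the old norm is infinite the bound holds trivially.
[cite: FeldmanKnorrerTrubowitz2004Ladders, Lemma II.16 (p.13 L19–33), proof p.13 L37–72] -/
theorem resectScaledNormMax_zero_le_of_support' (hD : D.Admissible) {cst : ℝ}
    (hχ : ChiDecayBound D cst) {l l' r r' : ℕ} (hl' : 1 ≤ l') (hl : l' ≤ l) (hr' : 1 ≤ r')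
    (hr : r' ≤ r) (f : FourLegFn)
    (hf : ∀ (i : LegKind) (s' : Fin 4 → Arc), Measurable fun y : Fin 4 → SpT => f i y s')
    (hsupp : scaledNormMax D l' r' 0 0 0 f ≠ ⊤ → ∀ (i : LegKind) (s s' : Fin 4 → Arc) (μ : Fin 4),
      AdmissibleLabels (D.Sig l) (D.Sig r) i s → AdmissibleLabels (D.Sig l') (D.Sig r') i s' →
      i μ = 1 → ((μ.val < 2 ∧ l ≠ l') ∨ (2 ≤ μ.val ∧ r ≠ r')) →
      ¬ (extSector D.S D.e D.fr (if μ.val < 2 then l else r) (s μ) ∩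
          extSector D.S D.e D.fr (if μ.val < 2 then l' else r') (s' μ)).Nonempty →
      ∀ y, resectTerm D l' r' l r f i s s' y = 0) :
    resectScaledNormMax D l' r' l r 0 0 0 f ≤
      3 ^ 4 * ENNReal.ofReal (max 1 cst) ^ 4 * scaledNormMax D l' r' 0 0 0 f := by
  by_cases htop : scaledNormMax D l' r' 0 0 0 f = ⊤
  · have hC : (3 ^ 4 * ENNReal.ofReal (max 1 cst) ^ 4 : ℝ≥0∞) ≠ 0 :=
      ne_of_gt (lt_of_lt_of_le zero_lt_one (one_le_resectConst cst))
    rw [htop, ENNReal.mul_top hC]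
    exact le_top
  · exact resectScaledNormMax_zero_le_of_support D hD hχ hl' hl hr' hr f hf (hsupp htop)

end FKTLadders

end Literature.MathematicalPhysics.QuantumLattice.FermiRG
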